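import Summits.ResolutionOfSingularities.ResolutionOfSingularities.Theorems.EquisingularLiftEquisingularLiftNatFirstOrderLineStrictTransform
import Summits.ResolutionOfSingularities.ResolutionOfSingularities.Theorems.EquisingularLiftEquisingularLiftNatOneStepLinePoints
import Summits.ResolutionOfSingularities.ResolutionOfSingularities.Theorems.EquisingularLiftEquisingularLiftNatMultiOrdinaryPointsJacobian
import HarnessLib

/-!
# [OURS] EL♮ FOR EVERY HYPERSURFACE WHOSE SINGULAR LOCUS IS A FIRST-ORDER COORDINATE `ℙʳ` — every dimension, every characteristic
# (non-isolated side of EL♮(3); cruxes `Theses.EquisingularLift.EquisingularLiftNat` / `…NatThree`, stmt-ResolutionOfSingularities-20038 / -20148)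

[OURS · leafhand-res-equisingularlift-9 g0, 2026-08-31; cell `pub/decomp-res`] AI-produced, weaker than expert review; NOT a statement of any manuscript;
nothing here proves resolution of singularities.  DEF-FREE helper; no `sorry`; standard axioms; ZERO named hypotheses.

Seat res-D-pv-013's T-ONESTEP-LINE ✓ `OneStepLine.elNatAt_oneStepLine` with its per-chart regularity certificates supplied by this hand's
✓ `FirstOrderLine.exists_strictTransform` (…NatFirstOrderLineStrictTransform):

* ★★ `FirstOrderLine.elNatAt_firstOrderLine` — `K = K̄` of characteristic `p`; `F` a prime form; `e` the surviving coordinates, `L = V(x_a : a ∉ range e) ≅ ℙʳ`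
  with `F ∈ (x_a : a ∉ range e)` (`L ⊆ H`), some such `x_a ∉ (F)`, the charts off `L` regular; and for every chart `c ∈ range e` a splitting
  `σ : K[y] ≃ R[z]` of the chart variables (cone variables onto the `z`'s) together with a polynomial presentation `ρ : K[ι] ≅ R[z]` (`z_j` variables,
  the other variables differentiating coefficients only — e.g. `R = K[u]`, `ρ = sumAlgEquiv`, ✓ `sumAlgEquiv_hDz/_hDuX/_hDuC`) under which
  `σ(F(x_c := 1)) = Φ + (Ψ₁ + Ψ')` (`Φ ≠ 0` a `z`-form of degree `μ`, `Ψ₁` a `z`-form of degree `μ + 1`, `Ψ' ∈ (z)^{μ+2}`) satisfies the FIRST-ORDER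
  CRITERION ALONG `L`: every prime of `R[z]` containing `Φ`, all `ρ∂_vρ⁻¹Φ` and `Ψ₁` contains all `z_j`.  Then `Theorems.EquisingularLift.ELNatAt p K (m+2) V₊(F) ι`:
  ONE blow-up of `ℙ^{m+2}_{𝕎(K)}` along `ℙʳ_{𝕎(K)}`.  The transversal type may degenerate along `L` (pinch points / Whitney umbrella), as long as the
  `u`-derivatives of the tangent cone keep the criterion.

Honest label: closes no registered stub; the non-isolated stub of 20148 is untouched by name.

References: [Hartshorne1977, II Prop. 5.9, II Ex. 7.12]; [StacksProject, Tags 0804, 02OS]; [Matsumura1987, Thm. 14.2] — through the cited tree files.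
-/

set_option linter.dupNamespace false -- mandated namespace `Summit.<Summit>.<Problem>` of this single-conjunct summit

noncomputable section

open CategoryTheory CategoryTheory.Limits AlgebraicGeometry TopologicalSpace
open MvPolynomial HomogeneousLocalization
open Literature.AlgebraicGeometry.Resolution
open Literature.AlgebraicGeometry.Motives Literature.AlgebraicGeometry.Motives.SmoothHypersurface
open Literature.AlgebraicGeometry.Motives.ProjectiveSpace
open AlgebraicGeometry.Scheme.IdealSheafData
open Summit.ResolutionOfSingularities.ResolutionOfSingularities.Cruxes.EquisingularLift.StrataSplit

namespace Summit.ResolutionOfSingularities.ResolutionOfSingularities.Cruxes.EquisingularLiftNat.Sections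

namespace FirstOrderLine

/-- ★★ **EL♮ HOLDS FOR EVERY HYPERSURFACE WHOSE SINGULAR LOCUS IS A FIRST-ORDER COORDINATE `ℙʳ`, IN EVERY DIMENSION AND CHARACTERISTIC** (see the module
docstring for the hypotheses; ✓ `OneStepLine.elNatAt_oneStepLine` + ✓ `FirstOrderLine.exists_strictTransform`; radicality of the chart equations from
primality, ✓ `MultiOrd.radical_span_dehomogenize_eq_of_prime`). [OURS] [cite: Hartshorne1977, II Ex. 7.12] [cite: Matsumura1987, Thm. 14.2] -/
theorem elNatAt_firstOrderLine (p : ℕ) (hp : p.Prime) (K : Type) [Field K] [CharP K p] [IsAlgClosed K] {m : ℕ}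
    (F : MvPolynomial (Fin (m + 2 + 1)) K) {d : ℕ} (hF : F.IsHomogeneous d) (hFp : Prime F)
    {r : ℕ} (e : Fin (r + 1) → Fin (m + 2 + 1)) (he : Function.Injective e)
    (hFmem : F ∈ Ideal.span ((fun a => (X a : MvPolynomial (Fin (m + 2 + 1)) K)) '' {a | a ∉ Set.range e}))
    (hXa : ∃ a, a ∉ Set.range e ∧ (X a : MvPolynomial (Fin (m + 2 + 1)) K) ∉ Ideal.span {F})
    (hoff : letI := MvPolynomial.gradedAlgebra (σ := Fin (m + 2 + 1)) (R := K)
      ∀ c, c ∉ Set.range e → IsRegularRing (ChartRing F c hF))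
    (hfo : ∀ c ∈ Set.range e, ∃ (M : ℕ) (R : Type) (_ : CommRing R) (_ : IsDomain R)
      (σ : MvPolynomial (Fin (m + 2)) K ≃+* MvPolynomial (Fin (M + 1)) R),
      (∀ j : Fin (m + 2), c.succAbove j ∉ Set.range e → ∃ i : Fin (M + 1), σ (X j) = X i) ∧
      (∀ i : Fin (M + 1), ∃ j : Fin (m + 2), c.succAbove j ∉ Set.range e ∧ σ (X j) = X i) ∧
      ∃ (Φ Ψ₁ Ψ' : MvPolynomial (Fin (M + 1)) R) (μ : ℕ), Φ.IsHomogeneous μ ∧ Φ ≠ 0 ∧ Ψ₁.IsHomogeneous (μ + 1) ∧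
        Ψ' ∈ Ideal.span (Set.range (X : Fin (M + 1) → MvPolynomial (Fin (M + 1)) R)) ^ (μ + 2) ∧
        σ (ProjectiveSpace.dehomogenize K c F) = Φ + (Ψ₁ + Ψ') ∧
        ∃ (ι : Type) (_ : Finite ι) (ρ : MvPolynomial ι K ≃+* MvPolynomial (Fin (M + 1)) R) (ιz : Fin (M + 1) → ι),
          (∀ (j : Fin (M + 1)) (q : MvPolynomial (Fin (M + 1)) R), ρ (pderiv (ιz j) (ρ.symm q)) = pderiv j q) ∧
          (∀ v, v ∉ Set.range ιz → ∀ j : Fin (M + 1), ρ (pderiv v (ρ.symm (X j))) = 0) ∧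
          (∀ v, v ∉ Set.range ιz → ∀ a : R, ∃ a' : R, ρ (pderiv v (ρ.symm (C a))) = C a') ∧
          ∀ P : Ideal (MvPolynomial (Fin (M + 1)) R), P.IsPrime → Φ ∈ P → (∀ v : ι, ρ (pderiv v (ρ.symm Φ)) ∈ P) → Ψ₁ ∈ P →
            ∀ j, (X j : MvPolynomial (Fin (M + 1)) R) ∈ P) :
    letI := MvPolynomial.gradedAlgebra (σ := Fin (m + 2 + 1)) (R := K)
    Theorems.EquisingularLift.ELNatAt p K (m + 2) (hypersurface F).left (hypersurfaceι F).left := by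
  letI := MvPolynomial.gradedAlgebra (σ := Fin (m + 2 + 1)) (R := K)
  refine OneStepLine.elNatAt_oneStepLine p hp K F hF hFp e he hFmem hXa hoff fun c hc => ?_
  obtain ⟨M, R, _, _, σ, hσ₁, hσ₂, Φ, Ψ₁, Ψ', μ, hΦ, hΦ0, hΨ₁, hΨ', hdeh, ι, _, ρ, ιz, hDz, hDuX, hDuC, hcrit⟩ := hfo c hc
  refine ⟨M, R, inferInstance, inferInstance, σ, hσ₁, hσ₂, Φ, Ψ₁ + Ψ', μ, hΦ, hΦ0, ?_, hdeh,
    MultiOrd.radical_span_dehomogenize_eq_of_prime F hF hFp c, fun l => ?_⟩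
  · refine Ideal.add_mem _ ?_ (Ideal.pow_le_pow_right (by omega) hΨ')
    change Ψ₁ ∈ MvPolynomial.idealOfVars (Fin (M + 1)) R ^ (μ + 1)
    refine (MvPolynomial.mem_pow_idealOfVars_iff (μ + 1) Ψ₁).mpr fun d hd => ?_
    have h := hΨ₁ (mem_support_iff.mp hd)
    rw [Finsupp.degree_eq_weight_one]
    exact h.symm.le
  · obtain ⟨G, hG, hreg⟩ := exists_strictTransform ρ ιz hDz hDuX hDuC Φ Ψ₁ Ψ' hΦ hΨ₁ hΨ' hcrit l
    exact ⟨G, hG, fun P _ hP => hreg P hP⟩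

end FirstOrderLine

end Summit.ResolutionOfSingularities.ResolutionOfSingularities.Cruxes.EquisingularLiftNat.Sections

end
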